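/-
Copyright: the b2b-balaban cell (near-miss cell 7), T⁴-continuum fan-out, lineage t4-ne7b-p3 (node U5c LARGE-DEVIATION
member P3).  Released under the licence of the surrounding project.
-/
import Mathlib.Combinatorics.SimpleGraph.Finite
import Mathlib.Combinatorics.SimpleGraph.Connectivity.Connected
import Literature.MathematicalPhysics.QuantumFieldTheory.Balaban1983to89.T4WeightBudget

/-!
# Space-time Peierls ∕ Cramér route for NE7b — the LEAVES, statement level (skeleton `t4/skeletons/NE7b-t4-ne7b-p3.md`)

Summits-side STAGED file of the T⁴-continuum cell (rung (B)+1 on a FINITE torus only; NOT infinite volume, NOT the mass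
gap, NOT the Clay statement; NOT a proof of the spine estimate NE7b).  Lineage `t4-ne7b-p3` (generation 1), node U5c.
[folklore] statement-level typing; nothing is quoted from print and nothing printed is asserted; no `[cite:]` tag.
Every `def … : Prop` below is a HYPOTHESIS SHAPE to be PROVED by the swarm (A1, A2c, A3b, A3-arithmetic) or to be
DISCHARGED BY A READING (A2b, A3e) — none is asserted, none is a fact about Bałaban's expansion.

CONTENTS.  §1 leaf A1 `SiteAnimalBound` (site animals through a vertex in a graph of bounded degree).  §2 the abstract
OCCUPANCY MODEL (`OccModel`: terms, occupied cells, adjacency, scale), contours (`IsContour` = connected component of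
the occupied set), leaf A2c `ContourCover` and leaf A3 `PinnedContourBound` as Props over it.  §3 the CONTOUR LEDGER
arithmetic «A3b ∧ A3c ∧ A3d ⇒ A3's rate»: `surplus_ge_rate_mul_vol` (PROVED): volume accounting + income lower bound +
banking ⇒ `(income − maintenance) ≥ s · volume` with `s = min(γA·p̄₀²/(2C₁), p̄₀/(2C₂(N′+1)))`.

HONEST DEPENDENCY (cell, verbatim): continuum YM on T⁴ ⇐ BetaPertH ∧ nine spine estimates (0/9 proved); BetaPertH ⇐
(D1) ∧ (D4) ∧ CAP+tail; G-an2-4 gates asym, D1 and NE2/3/4.  This file changes none of it.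
-/

open Finset

namespace Summit.QuantumFields.BalabanUV.T4Continuum.SpaceTimePeierlsLeaves

/-! ## §1 Leaf A1: site animals -/

/-- LEAF A1 (hypothesis shape, to be PROVED — folklore, Lyons–Peres Ex. 7.39 / Grimmett §3.1): in a finite simple
graph all of whose degrees are `≤ Δ`, the connected induced vertex sets of size `n` containing a fixed vertex number at
most `Δ₁ ^ n` (intended `Δ₁ = e·Δ`, or any `Δ₁` with `log Δ₁ = O(log Δ)`). [folklore] -/
def SiteAnimalBound (Δ : ℕ) (Δ₁ : ℝ) : Prop :=
  ∀ (V : Type) [Fintype V] [DecidableEq V] (G : SimpleGraph V) [DecidableRel G.Adj],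
    (∀ v, G.degree v ≤ Δ) → ∀ (v : V) (n : ℕ),
      (Nat.card {S : Finset V // v ∈ S ∧ S.card = n ∧ (G.induce (S : Set V)).Connected} : ℝ) ≤ Δ₁ ^ n

/-! ## §2 The occupancy model, contours, leaves A2c and A3 as Props -/

/-- THE ABSTRACT OCCUPANCY MODEL of one run at one `(K, t)`: the finite family of terms `T`, the occupied space-time
cells `Occ τ` of each term, the space-time adjacency `Adj` (lateral touching + vertical parent), the scale of a cell.
(A carrier; the READING A2b instantiates it with Bałaban's histories — not done here.) [folklore] -/
structure OccModel (ι Cell : Type*) where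
  /-- the terms of the run -/
  T : Finset ι
  /-- the occupied cells of a term (blocks inside its live large-field regions, all scales) -/
  Occ : ι → Finset Cell
  /-- space-time adjacency -/
  Adj : SimpleGraph Cell
  /-- the scale of a cell -/
  scale : Cell → ℕ

variable {ι Cell : Type*}

/-- `M.IsContour τ 𝒦`: `𝒦` is a CONTOUR of the term `τ` — a nonempty connected component of its occupied set
(inside `Occ τ`, connected in `Adj`, and no occupied cell outside `𝒦` is adjacent to `𝒦`). [folklore] -/
def OccModel.IsContour (M : OccModel ι Cell) (τ : ι) (𝒦 : Finset Cell) : Prop :=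
  𝒦 ⊆ M.Occ τ ∧ 𝒦.Nonempty ∧ (M.Adj.induce (𝒦 : Set Cell)).Connected ∧
    ∀ c ∈ M.Occ τ, c ∉ 𝒦 → ∀ c' ∈ 𝒦, ¬ M.Adj.Adj c c'

/-- LEAF A2c (hypothesis shape, to be PROVED over the index model + the reading A2b): every bad term has a contour
meeting EVERY scale of the window `[jlo, K]` (in the application `jlo < j⋆(K)`: the contour of the old structure's
birth cell, vertically connected up to the final scale). [folklore] -/
def OccModel.ContourCover (M : OccModel ι Cell) (Bad : Finset ι) (jlo K : ℕ) : Prop :=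
  Bad ⊆ M.T ∧ ∀ τ ∈ Bad, ∃ 𝒦, M.IsContour τ 𝒦 ∧ ∀ u ∈ Icc jlo K, ∃ c ∈ 𝒦, M.scale c = u

open Classical in
/-- LEAF A3 (hypothesis shape — the PINNED-CONTOUR BOUND, one run, absolute; to be derived from A3a–A3f): the terms
having a given contour weigh at most `q ^ |𝒦| · nup` (`q = e^{−s₁}`). [folklore] -/
def OccModel.PinnedContourBound (M : OccModel ι Cell) (A : ι → ℝ) (q nup : ℝ) : Prop :=
  ∀ 𝒦 : Finset Cell, ∑ τ ∈ M.T.filter (fun τ => M.IsContour τ 𝒦), A τ ≤ q ^ 𝒦.card * nup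

/-- A contour meeting every scale of `[jlo, K]` has at least `K + 1 − jlo` cells (the deterministic half of the
Cramér step; = `SpaceTimePeierls.card_Icc_le_card_of_meets`). [folklore] -/
theorem OccModel.card_ge_of_cover (M : OccModel ι Cell) {𝒦 : Finset Cell} {jlo K : ℕ}
    (h : ∀ u ∈ Icc jlo K, ∃ c ∈ 𝒦, M.scale c = u) : K + 1 - jlo ≤ 𝒦.card := by
  have hc : (Icc jlo K).card ≤ 𝒦.card :=
    card_le_card_of_surjOn M.scale fun u hu => by
      obtain ⟨c, hc, rfl⟩ := h u hu
      exact ⟨c, hc, rfl⟩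
  simpa [Nat.card_Icc] using hc

/-! ## §3 The contour ledger: A3b ∧ A3c ∧ A3d ⇒ the per-cell rate of A3 (PROVED arithmetic) -/

/-- THE LEDGER OF ONE CONTOUR (the genealogy-level data the leaves A3b–A3d talk about): its volume `vol = |𝒦|`, its
created fatness `fat = Σ_created (d′+1)`, its numbers of births ∕ renewals ∕ mergers, its total epoch length, and its
accumulated income and maintenance (print's κ-balance read as an energy functional — leaf A3a). [folklore] -/
structure ContourLedger where
  /-- number of occupied cells -/
  vol : ℕ
  /-- `Σ (d′ + 1)` over the created regions -/
  fat : ℕ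
  /-- created components -/
  births : ℕ
  /-- renewal events -/
  renewals : ℕ
  /-- merger events -/
  mergers : ℕ
  /-- total length of the event-free epochs -/
  epochLen : ℕ
  /-- accumulated income (creation and renewal factors, in units of the exponent) -/
  income : ℝ
  /-- accumulated maintenance (print's per-scale costs) -/
  maint : ℝ

/-- LEAF A3b (hypothesis shape, to be PROVED in the index model): VOLUME ACCOUNTING
`|𝒦| ≤ C₁·Σ_created(d′+1) + C₂·(Σ_epochs length + #births)`. [folklore] -/
def ContourLedger.VolumeAccounting (C₁ C₂ : ℝ) (ℓ : ContourLedger) : Prop :=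
  (ℓ.vol : ℝ) ≤ C₁ * ℓ.fat + C₂ * (ℓ.epochLen + ℓ.births)

/-- LEAF A3c (hypothesis shape; printed per-event income items + tree counting): INCOME LOWER BOUND
`income ≥ γA·p̄₀²·fat + p̄₀·(births + renewals + mergers)`. [folklore] -/
def ContourLedger.IncomeLower (γA pbar : ℝ) (ℓ : ContourLedger) : Prop :=
  γA * pbar ^ 2 * ℓ.fat + pbar * (ℓ.births + ℓ.renewals + ℓ.mergers) ≤ ℓ.income

/-- LEAF A3d (hypothesis shape = the node's R1 «banking» in this route's form; NOT PRINTED as a statement): along the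
genealogy, MAINTENANCE IS AT MOST HALF THE INCOME. [folklore] -/
def ContourLedger.Banking (ℓ : ContourLedger) : Prop := ℓ.maint ≤ ℓ.income / 2

/-- The window reading R2 in ledger form: total epoch length ≤ `N′ ×` number of epochs
(`#epochs = births + renewals + mergers`). [folklore] -/
def ContourLedger.Windows (N' : ℝ) (ℓ : ContourLedger) : Prop :=
  (ℓ.epochLen : ℝ) ≤ N' * (ℓ.births + ℓ.renewals + ℓ.mergers)

/-- **A3b ∧ A3c ∧ A3d ∧ R2 ⇒ THE PER-CELL RATE** (the arithmetic step «⟹ A3» of the skeleton, PROVED): with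
`s := min (γA·p̄₀²/(2C₁)) (p̄₀/(2C₂(N′+1)))` and nonnegative constants,
`s · |𝒦| ≤ income − maintenance`.  (The history multiplicity `e^{c₃|𝒦|}` of A3f is then netted: `s₁ = s − c₃`.)
[folklore] -/
theorem ContourLedger.surplus_ge_rate_mul_vol (ℓ : ContourLedger) {C₁ C₂ γA pbar N' : ℝ} (hC₁ : 0 < C₁)
    (hC₂ : 0 < C₂) (hγ : 0 ≤ γA) (hp : 0 ≤ pbar) (hN : 0 ≤ N') (hvol : ℓ.VolumeAccounting C₁ C₂)
    (hinc : ℓ.IncomeLower γA pbar) (hbank : ℓ.Banking) (hwin : ℓ.Windows N') :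
    min (γA * pbar ^ 2 / (2 * C₁)) (pbar / (2 * C₂ * (N' + 1))) * ℓ.vol ≤ ℓ.income - ℓ.maint := by
  set s := min (γA * pbar ^ 2 / (2 * C₁)) (pbar / (2 * C₂ * (N' + 1))) with hs
  have hs0 : 0 ≤ s := le_min (by positivity) (by positivity)
  have hs1 : s ≤ γA * pbar ^ 2 / (2 * C₁) := min_le_left _ _
  have hs2 : s ≤ pbar / (2 * C₂ * (N' + 1)) := min_le_right _ _
  -- abbreviations
  set E : ℝ := (ℓ.births : ℝ) + ℓ.renewals + ℓ.mergers with hE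
  have hE0 : 0 ≤ E := by positivity
  have hfat0 : (0 : ℝ) ≤ ℓ.fat := by positivity
  -- volume ≤ C₁ fat + C₂ (N'+1) E
  have hvol' : (ℓ.vol : ℝ) ≤ C₁ * ℓ.fat + C₂ * ((N' + 1) * E) := by
    have h1 : (ℓ.epochLen : ℝ) + ℓ.births ≤ (N' + 1) * E := by
      have hb : (ℓ.births : ℝ) ≤ E := by
        rw [hE]; have : (0:ℝ) ≤ ℓ.renewals := by positivity
        have : (0:ℝ) ≤ ℓ.mergers := by positivity
        linarith
      have := hwin
      unfold ContourLedger.Windows at this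
      nlinarith
    have := hvol
    unfold ContourLedger.VolumeAccounting at this
    nlinarith [mul_le_mul_of_nonneg_left h1 hC₂.le]
  -- s·vol ≤ s C₁ fat + s C₂ (N'+1) E ≤ (γA p̄₀²/2) fat + (p̄₀/2) E
  have hA : s * (C₁ * ℓ.fat) ≤ γA * pbar ^ 2 / 2 * ℓ.fat := by
    have : s * C₁ ≤ γA * pbar ^ 2 / 2 := by
      calc s * C₁ ≤ γA * pbar ^ 2 / (2 * C₁) * C₁ := mul_le_mul_of_nonneg_right hs1 hC₁.le
        _ = γA * pbar ^ 2 / 2 := by field_simp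
    calc s * (C₁ * ℓ.fat) = (s * C₁) * ℓ.fat := by ring
      _ ≤ γA * pbar ^ 2 / 2 * ℓ.fat := mul_le_mul_of_nonneg_right this hfat0
  have hB : s * (C₂ * ((N' + 1) * E)) ≤ pbar / 2 * E := by
    have : s * (C₂ * (N' + 1)) ≤ pbar / 2 := by
      calc s * (C₂ * (N' + 1)) ≤ pbar / (2 * C₂ * (N' + 1)) * (C₂ * (N' + 1)) :=
            mul_le_mul_of_nonneg_right hs2 (by positivity)
        _ = pbar / 2 := by field_simp
    calc s * (C₂ * ((N' + 1) * E)) = (s * (C₂ * (N' + 1))) * E := by ring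
      _ ≤ pbar / 2 * E := mul_le_mul_of_nonneg_right this hE0
  have hinc' : γA * pbar ^ 2 * ℓ.fat + pbar * E ≤ ℓ.income := by
    have := hinc; unfold ContourLedger.IncomeLower at this; rw [hE]; linarith
  have hbank' : ℓ.maint ≤ ℓ.income / 2 := hbank
  calc s * ℓ.vol ≤ s * (C₁ * ℓ.fat + C₂ * ((N' + 1) * E)) := mul_le_mul_of_nonneg_left hvol' hs0
    _ = s * (C₁ * ℓ.fat) + s * (C₂ * ((N' + 1) * E)) := by ring
    _ ≤ γA * pbar ^ 2 / 2 * ℓ.fat + pbar / 2 * E := add_le_add hA hB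
    _ = (γA * pbar ^ 2 * ℓ.fat + pbar * E) / 2 := by ring
    _ ≤ ℓ.income / 2 := by linarith
    _ ≤ ℓ.income - ℓ.maint := by linarith

/-- … and the exponential form consumed by the pinned-contour bound: `e^{−(income − maint)} ≤ (e^{−s})^{|𝒦|}`.
[folklore] -/
theorem ContourLedger.exp_neg_surplus_le (ℓ : ContourLedger) {C₁ C₂ γA pbar N' : ℝ} (hC₁ : 0 < C₁)
    (hC₂ : 0 < C₂) (hγ : 0 ≤ γA) (hp : 0 ≤ pbar) (hN : 0 ≤ N') (hvol : ℓ.VolumeAccounting C₁ C₂)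
    (hinc : ℓ.IncomeLower γA pbar) (hbank : ℓ.Banking) (hwin : ℓ.Windows N') :
    Real.exp (-(ℓ.income - ℓ.maint))
      ≤ Real.exp (-(min (γA * pbar ^ 2 / (2 * C₁)) (pbar / (2 * C₂ * (N' + 1))))) ^ ℓ.vol := by
  rw [← Real.exp_nat_mul, Real.exp_le_exp]
  have := ℓ.surplus_ge_rate_mul_vol hC₁ hC₂ hγ hp hN hvol hinc hbank hwin
  linarith

end Summit.QuantumFields.BalabanUV.T4Continuum.SpaceTimePeierlsLeaves
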